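import Mathlib.Combinatorics.SimpleGraph.Bipartite
import Literature.Probability.LatticeModels.BackboneCurrent
import HarnessLib

/-!
# The even discrete torus `(ℤ/Lℤ)^d` is connected, bipartite and balanced

Topic `Probability/LatticeModels`. Elementary lattice facts used wherever a theorem about
antiferromagnets on a *connected bipartite graph with equinumerous sublattices* (Lieb–Mattis 1962,
Marshall; Lieb 1989; Dyson–Lieb–Simon 1978) is applied to the periodic box of EVEN side:

* `torusGraph_connected_of_proj` — the nearest-neighbour torus graph `torusGraph d L`
  (`LatticeGraph.lean`) is connected, for every `d` and `L` (projected lattice paths,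
  `torusGraph_reachable_proj` of `BackboneCurrent.lean`); Friedli–Velenik (2017) §3.1.
* `torusSiteParity hL x = Σᵢ xᵢ mod 2` (`2 ∣ L`), `evenSublattice L hL = {x : ε(x) = 0}`,
  `torusSiteParity_of_adj` (the parity flips along every edge),
  `torusGraph_isBipartiteWith_evenSublattice` — the even torus is bipartite in the parity classes,
  `card_compl_evenSublattice` — the two classes are equinumerous (`x ↦ x + eᵢ`, needs `d ≥ 1`,
  witnessed by an index `i : Fin d`). Dyson–Lieb–Simon (1978) §2 (the setting "Λ ⊂ ℤ^ν a cube of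
  even side with periodic boundary conditions … Λ = A ∪ B").

Everything is proved; the two definitions have bodies; no named facts. (Moved here from the
pub-hubbard cell file `Summits/HubbardSuperconductivity/HubbardLadder/ObservableWindowSingletTorus`
at the reviewer's request, p200204: known mathematics on a Literature object belongs in Literature.)
References: [cite: DysonLiebSimon1978, §2]; [cite: FriedliVelenik2017, §3.1]; used with
[cite: LiebMattis1962, Theorem 2].
-/

namespace Literature.Probability.LatticeModels

open Finset

noncomputable section

section EvenTorus

variable {d : ℕ}

/-- **The torus graph `(ℤ/Lℤ)^d` is connected** (projected lattice paths, `torusGraph_reachable_proj`;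
every `L`, every `d` — for `d = 0` or `L ≤ 1` the graph has one vertex). Friedli–Velenik (2017) §3.1
(nearest-neighbour graph of the torus `𝕋_L = ℤ^d/Lℤ^d`). [cite: FriedliVelenik2017, §3.1] [folklore] -/
theorem torusGraph_connected_of_proj (d L : ℕ) : (torusGraph d L).Connected := by
  have hs : Function.Surjective (Torus.proj (d := d) L) := by
    intro x
    refine ⟨fun i => (ZMod.intCast_surjective (x i)).choose, funext fun i => ?_⟩
    exact (ZMod.intCast_surjective (x i)).choose_spec
  rw [SimpleGraph.connected_iff]
  refine ⟨fun x y => ?_, ⟨fun _ => 0⟩⟩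
  obtain ⟨x', rfl⟩ := hs x
  obtain ⟨y', rfl⟩ := hs y
  exact torusGraph_reachable_proj L x' y'

/-- The sublattice parity `ε(x) = Σᵢ xᵢ mod 2` of a site of a torus of even side (well defined
through `ZMod.castHom (2 ∣ L)`). Dyson–Lieb–Simon (1978) §2: "Λ is bipartite: Λ = A ∪ B with
nearest neighbours of A-sites in B" for the cube of even side with periodic b.c.
[cite: DysonLiebSimon1978, §2] [folklore] -/
def torusSiteParity {L : ℕ} (hL : 2 ∣ L) (x : TorusSite d L) : ZMod 2 :=
  ∑ j, ZMod.castHom hL (ZMod 2) (x j)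

/-- The parity flips along every lattice direction (`L` even). [cite: DysonLiebSimon1978, §2] [folklore] -/
theorem torusSiteParity_add_single {L : ℕ} (hL : 2 ∣ L) (x : TorusSite d L) (i : Fin d) :
    torusSiteParity hL (x + Pi.single i 1) = torusSiteParity hL x + 1 := by
  unfold torusSiteParity
  simp only [Pi.add_apply, map_add, sum_add_distrib, add_right_inj]
  rw [← map_sum, sum_pi_single' i (1 : ZMod L) univ, if_pos (mem_univ i), map_one]

/-- The parity flips along every edge of the torus graph (`L` even). [cite: DysonLiebSimon1978, §2] [folklore] -/
theorem torusSiteParity_of_adj {L : ℕ} (hL : 2 ∣ L) {x y : TorusSite d L}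
    (hxy : (torusGraph d L).Adj x y) : torusSiteParity hL y = torusSiteParity hL x + 1 := by
  have h11 : (1 : ZMod 2) + 1 = 0 := by decide
  rw [torusGraph_adj_iff] at hxy
  obtain ⟨-, ⟨i, rfl⟩ | ⟨i, rfl⟩⟩ := hxy
  · exact torusSiteParity_add_single hL x i
  · rw [torusSiteParity_add_single hL y i, add_assoc, h11, add_zero]

/-- The even sublattice `A = {x : ε(x) = 0}` of a torus of even side. [cite: DysonLiebSimon1978, §2] [folklore] -/
def evenSublattice (L : ℕ) [NeZero L] (hL : 2 ∣ L) : Finset (TorusSite d L) :=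
  univ.filter fun x => torusSiteParity hL x = 0

/-- Membership in the even sublattice (unfolding lemma). [cite: DysonLiebSimon1978, §2] [folklore] -/
theorem mem_evenSublattice_iff (L : ℕ) [NeZero L] (hL : 2 ∣ L) (x : TorusSite d L) :
    x ∈ evenSublattice (d := d) L hL ↔ torusSiteParity hL x = 0 := by
  simp [evenSublattice]

/-- **The even torus is bipartite** in the parity sublattices `A`, `Aᶜ` (every edge joins `A` to `Aᶜ`).
Dyson–Lieb–Simon (1978) §2. [cite: DysonLiebSimon1978, §2] [folklore] -/
theorem torusGraph_isBipartiteWith_evenSublattice (L : ℕ) [NeZero L] (hL : 2 ∣ L) :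
    (torusGraph d L).IsBipartiteWith (evenSublattice (d := d) L hL : Set (TorusSite d L))
      (↑(evenSublattice (d := d) L hL))ᶜ := by
  have h01 : ∀ t : ZMod 2, t = 0 ∨ t = 1 := by decide
  refine ⟨disjoint_compl_right, fun v w hvw => ?_⟩
  have hflip := torusSiteParity_of_adj hL hvw
  simp only [Set.mem_compl_iff, Finset.mem_coe, mem_evenSublattice_iff]
  rcases h01 (torusSiteParity hL v) with h0 | h1
  · left
    refine ⟨h0, ?_⟩
    rw [hflip, h0]; decide
  · right
    refine ⟨?_, ?_⟩
    · rw [h1]; decide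
    · rw [hflip, h1]; decide

/-- **The parity sublattices of the even torus are equinumerous**, `|Aᶜ| = |A|` (`x ↦ x + eᵢ` is a
bijection `A → Aᶜ`; needs a direction `i`, i.e. `d ≥ 1`). [cite: DysonLiebSimon1978, §2] [folklore] -/
theorem card_compl_evenSublattice (L : ℕ) [NeZero L] (hL : 2 ∣ L) (i : Fin d) :
    (evenSublattice (d := d) L hL)ᶜ.card = (evenSublattice (d := d) L hL).card := by
  have h10 : (1 : ZMod 2) ≠ 0 := by decide
  symm
  refine Finset.card_bij (fun x _ => x + Pi.single i 1) (fun x hx => ?_) (fun x₁ _ x₂ _ h => ?_)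
    (fun y hy => ?_)
  · rw [Finset.mem_compl, mem_evenSublattice_iff, torusSiteParity_add_single,
      (mem_evenSublattice_iff L hL x).1 hx, zero_add]
    exact h10
  · exact add_right_cancel h
  · refine ⟨y - Pi.single i 1, ?_, sub_add_cancel y _⟩
    rw [Finset.mem_compl, mem_evenSublattice_iff] at hy
    have h := torusSiteParity_add_single hL (y - Pi.single i 1) i
    rw [sub_add_cancel] at h
    rw [mem_evenSublattice_iff]
    have h01 : ∀ t : ZMod 2, t = 0 ∨ t = 1 := by decide
    rcases h01 (torusSiteParity hL (y - Pi.single i 1)) with h0 | h1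
    · exact h0
    · exfalso; apply hy; rw [h, h1]; decide

end EvenTorus

end

end Literature.Probability.LatticeModels
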